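import Summits.CriticalPhenomena.SAWScalingLimit.Theorems.SAWReversalUpgradeAttachReversalReversalB

/-!
# Attachment reversal: exact time reversal, part B' (the degenerate ends of the trimmed interval)

Helper file for item `AttachReversal` of route `SAWReversalUpgrade` (stmt-CriticalPhenomena-18007).
Setting of part A (`(D; a, b)`, `φ`, `φ' = φ ∘ ι_c`, `Φ`, `Φ'`, `0 < e ≤ 1/2`, `U` continuous with
values in `closure D` and endpoints `U 0, U 1 ∉ {a, b}`, `U' u = U (1 - u)`), with the trimmed
interval `[i, j]` nonempty. The cut times at the two DEGENERATE ends (the trimmed interval ends at a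
visit of `b`, or starts at a visit of `a`) of the primed data (computed in `D.swap` from `U'`) and of
the unprimed data:

* `rev_of_lastB` — `U j = b`: `s' = 0`, `p' = 0`, `uMid' = 1 - j`, `vMid = j`;
* `rev_of_firstA` — `U i = a`: `s = 0`, `p = 0`, `uMid = i`, `vMid' = 1 - i`.
-/

noncomputable section

open Set Function Filter Topology Complex
open UpperHalfPlane (upperHalfPlaneSet)
open Literature.Probability.RandomPlanarGeometry

namespace Summit.CriticalPhenomena.SAWScalingLimit.Theorems.AttachReversal

variable {D : DobrushinDomain} {φ : ConformalEquiv upperHalfPlaneSet D.carrier}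
  {φ' : ConformalEquiv upperHalfPlaneSet D.swap.carrier} {c e : ℝ} {U : ℝ → ℂ}

/-! ### The degenerate ends: `U j = b` and `U i = a` -/

/-- Membership in the primed trimmed interval is membership of the reflected time in the unprimed
one. -/
theorem mem_Icc_rev_iff {x y : ℂ} {U : ℝ → ℂ} {u : ℝ} :
    u ∈ Icc (lastA y (fun u => U (1 - u))) (firstB x (fun u => U (1 - u))) ↔
      1 - u ∈ Icc (lastA x U) (firstB y U) := by
  rw [rev_lastA, rev_firstB, mem_Icc, mem_Icc]
  constructor <;> rintro ⟨h1, h2⟩ <;> constructor <;> linarith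

/-- **Case `U j = b`**: `p' = 0`, `s' = 0`, `uMid' = 1 - j`, `vMid = j`. -/
theorem rev_of_lastB (hφ : D.IsChordalUniformizing φ) (hφ' : D.swap.IsChordalUniformizing φ')
    (hc : 0 < c) (heq : ∀ z ∈ upperHalfPlaneSet, φ' z = φ (-((c : ℂ) * z)⁻¹)) (he : 0 < e)
    (he' : e ≤ 1 / 2) (hcl : ∀ s, U s ∈ closure D.carrier)
    (hij : lastA (D.pt 0) U ≤ firstB (D.pt 1) U) (hjb : U (firstB (D.pt 1) U) = D.pt 1) :
    pAcc (D.pt 1) φ'.boundaryExtension e (fun u => U (1 - u)) = 0 ∧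
    sAcc (D.pt 1) (D.pt 0) φ'.boundaryExtension e (fun u => U (1 - u)) = 0 ∧
    uMid (D.pt 1) (D.pt 0) φ'.boundaryExtension e (fun u => U (1 - u)) = 1 - firstB (D.pt 1) U ∧
    vMid (D.pt 0) (D.pt 1) φ.boundaryExtension e U = firstB (D.pt 1) U := by
  have hM' : midSet (D.pt 1) (D.pt 0) φ'.boundaryExtension e (fun u => U (1 - u)) =
      midSet (D.pt 0) (D.pt 1) φ.boundaryExtension e U := rev_midSet hφ hφ' hc heq he he' hcl
  have hbM : D.pt 1 ∈ midSet (D.pt 0) (D.pt 1) φ.boundaryExtension e U :=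
    (pt_one_mem_midSet_iff hφ he he' hcl).2 ⟨hij, hjb⟩
  have hp' : pAcc (D.pt 1) φ'.boundaryExtension e (fun u => U (1 - u)) = 0 := by
    rw [rev_pAcc, hjb, hinv_apply, invFunOn_bExt_swap_pt_one hφ', sqz_zero (squeeze_spec' e)]
  have hΦ'0 : φ'.boundaryExtension 0 = D.pt 1 := bExt_swap_zero hφ'
  have hs' : sAcc (D.pt 1) (D.pt 0) φ'.boundaryExtension e (fun u => U (1 - u)) = 0 := by
    show sInf {s : ℝ | s ∈ Ioc (0:ℝ) 1 ∧ φ'.boundaryExtension ((s : ℂ) *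
      pAcc (D.pt 1) φ'.boundaryExtension e (fun u => U (1 - u))) ∈
        midSet (D.pt 1) (D.pt 0) φ'.boundaryExtension e (fun u => U (1 - u))} = 0
    have : {s : ℝ | s ∈ Ioc (0:ℝ) 1 ∧ φ'.boundaryExtension ((s : ℂ) *
        pAcc (D.pt 1) φ'.boundaryExtension e (fun u => U (1 - u))) ∈
          midSet (D.pt 1) (D.pt 0) φ'.boundaryExtension e (fun u => U (1 - u))} = Ioc 0 1 := by
      ext s
      simp only [mem_setOf_eq, hp', mul_zero, hΦ'0, hM', and_iff_left_iff_imp]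
      exact fun _ => hbM
    rw [this, csInf_Ioc zero_lt_one]
  have hZ : ∀ u, attZ (D.pt 0) φ'.boundaryExtension e (fun u => U (1 - u)) u =
      attZ (D.pt 1) φ.boundaryExtension e U (1 - u) := rev_attZ hφ hφ' hc heq he he' hcl
  have hu' : uMid (D.pt 1) (D.pt 0) φ'.boundaryExtension e (fun u => U (1 - u)) = 1 - firstB (D.pt 1) U := by
    show sInf {u : ℝ | u ∈ Icc (lastA (D.pt 1) fun u => U (1 - u)) (firstB (D.pt 0) fun u => U (1 - u)) ∧
      attZ (D.pt 0) φ'.boundaryExtension e (fun u => U (1 - u)) u =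
        φ'.boundaryExtension ((sAcc (D.pt 1) (D.pt 0) φ'.boundaryExtension e (fun u => U (1 - u)) : ℂ) *
          pAcc (D.pt 1) φ'.boundaryExtension e (fun u => U (1 - u)))} = 1 - firstB (D.pt 1) U
    have : {u : ℝ | u ∈ Icc (lastA (D.pt 1) fun u => U (1 - u)) (firstB (D.pt 0) fun u => U (1 - u)) ∧
        attZ (D.pt 0) φ'.boundaryExtension e (fun u => U (1 - u)) u =
          φ'.boundaryExtension ((sAcc (D.pt 1) (D.pt 0) φ'.boundaryExtension e (fun u => U (1 - u)) : ℂ) *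
            pAcc (D.pt 1) φ'.boundaryExtension e (fun u => U (1 - u)))} = {1 - firstB (D.pt 1) U} := by
      ext u
      simp only [mem_setOf_eq, mem_singleton_iff, hp', mul_zero, hΦ'0, hZ u, mem_Icc_rev_iff]
      constructor
      · rintro ⟨hu, hZb⟩
        rw [attZ_eq_pt_one_iff hφ he he' (hcl _)] at hZb
        have := eq_firstB_of_mem_Icc hu hZb
        linarith
      · rintro rfl
        rw [sub_sub_cancel]
        exact ⟨⟨hij, le_rfl⟩, attZ_of_eq hjb⟩
    rw [this, csInf_singleton]
  have hv : vMid (D.pt 0) (D.pt 1) φ.boundaryExtension e U = firstB (D.pt 1) U := by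
    show sSup ({u : ℝ | u ∈ Icc (lastA (D.pt 0) U) (firstB (D.pt 1) U) ∧ U (firstB (D.pt 1) U) = D.pt 1 ∧
        u = firstB (D.pt 1) U} ∪
      {u : ℝ | u ∈ Icc (lastA (D.pt 0) U) (firstB (D.pt 1) U) ∧ U (firstB (D.pt 1) U) ≠ D.pt 1 ∧
        attZ (D.pt 1) φ.boundaryExtension e U u =
          φ.boundaryExtension ((rEx (D.pt 0) (D.pt 1) φ.boundaryExtension e U : ℂ) *
            qEx (D.pt 1) φ.boundaryExtension e U)}) = firstB (D.pt 1) U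
    have h1 : {u : ℝ | u ∈ Icc (lastA (D.pt 0) U) (firstB (D.pt 1) U) ∧ U (firstB (D.pt 1) U) = D.pt 1 ∧
        u = firstB (D.pt 1) U} = {firstB (D.pt 1) U} := by
      ext u
      simp only [mem_setOf_eq, mem_singleton_iff]
      refine ⟨fun h => h.2.2, fun h => ⟨?_, hjb, h⟩⟩
      rw [h]; exact ⟨hij, le_rfl⟩
    have h2 : {u : ℝ | u ∈ Icc (lastA (D.pt 0) U) (firstB (D.pt 1) U) ∧ U (firstB (D.pt 1) U) ≠ D.pt 1 ∧
        attZ (D.pt 1) φ.boundaryExtension e U u =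
          φ.boundaryExtension ((rEx (D.pt 0) (D.pt 1) φ.boundaryExtension e U : ℂ) *
            qEx (D.pt 1) φ.boundaryExtension e U)} = ∅ := by
      ext u
      simp only [mem_setOf_eq, mem_empty_iff_false, iff_false, not_and]
      exact fun _ h _ => h hjb
    rw [h1, h2, union_empty, csSup_singleton]
  exact ⟨hp', hs', hu', hv⟩

/-- **Case `U i = a`**: `p = 0`, `s = 0`, `uMid = i`, `vMid' = 1 - i`. -/
theorem rev_of_firstA (hφ : D.IsChordalUniformizing φ) (φ' : ConformalEquiv upperHalfPlaneSet D.swap.carrier)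
    (he : 0 < e) (he' : e ≤ 1 / 2) (hcl : ∀ s, U s ∈ closure D.carrier)
    (hij : lastA (D.pt 0) U ≤ firstB (D.pt 1) U) (hia : U (lastA (D.pt 0) U) = D.pt 0) :
    pAcc (D.pt 0) φ.boundaryExtension e U = 0 ∧
    sAcc (D.pt 0) (D.pt 1) φ.boundaryExtension e U = 0 ∧
    uMid (D.pt 0) (D.pt 1) φ.boundaryExtension e U = lastA (D.pt 0) U ∧
    vMid (D.pt 1) (D.pt 0) φ'.boundaryExtension e (fun u => U (1 - u)) = 1 - lastA (D.pt 0) U := by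
  have haM : D.pt 0 ∈ midSet (D.pt 0) (D.pt 1) φ.boundaryExtension e U :=
    (pt_zero_mem_midSet_iff hφ he he' hcl).2 ⟨hij, hia⟩
  have hp : pAcc (D.pt 0) φ.boundaryExtension e U = 0 := by
    unfold pAcc
    rw [hia, hinv_apply, FaithfulAttach.invFun_pt_zero hφ, sqz_zero (squeeze_spec' e)]
  have hΦ0 : φ.boundaryExtension 0 = D.pt 0 := hφ.boundaryExtension_zero
  have hs : sAcc (D.pt 0) (D.pt 1) φ.boundaryExtension e U = 0 := by
    show sInf {s : ℝ | s ∈ Ioc (0:ℝ) 1 ∧ φ.boundaryExtension ((s : ℂ) * pAcc (D.pt 0) φ.boundaryExtension e U) ∈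
      midSet (D.pt 0) (D.pt 1) φ.boundaryExtension e U} = 0
    have : {s : ℝ | s ∈ Ioc (0:ℝ) 1 ∧ φ.boundaryExtension ((s : ℂ) * pAcc (D.pt 0) φ.boundaryExtension e U) ∈
        midSet (D.pt 0) (D.pt 1) φ.boundaryExtension e U} = Ioc 0 1 := by
      ext s
      simp only [mem_setOf_eq, hp, mul_zero, hΦ0, and_iff_left_iff_imp]
      exact fun _ => haM
    rw [this, csInf_Ioc zero_lt_one]
  have hu : uMid (D.pt 0) (D.pt 1) φ.boundaryExtension e U = lastA (D.pt 0) U := by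
    show sInf {u : ℝ | u ∈ Icc (lastA (D.pt 0) U) (firstB (D.pt 1) U) ∧
      attZ (D.pt 1) φ.boundaryExtension e U u =
        φ.boundaryExtension ((sAcc (D.pt 0) (D.pt 1) φ.boundaryExtension e U : ℂ) *
          pAcc (D.pt 0) φ.boundaryExtension e U)} = lastA (D.pt 0) U
    have : {u : ℝ | u ∈ Icc (lastA (D.pt 0) U) (firstB (D.pt 1) U) ∧
        attZ (D.pt 1) φ.boundaryExtension e U u =
          φ.boundaryExtension ((sAcc (D.pt 0) (D.pt 1) φ.boundaryExtension e U : ℂ) *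
            pAcc (D.pt 0) φ.boundaryExtension e U)} = {lastA (D.pt 0) U} := by
      ext u
      simp only [mem_setOf_eq, mem_singleton_iff, hp, mul_zero, hΦ0]
      constructor
      · rintro ⟨hu, hZa⟩
        rw [attZ_eq_pt_zero_iff hφ he he' (hcl _)] at hZa
        exact eq_lastA_of_mem_Icc hu hZa
      · rintro rfl
        refine ⟨⟨le_rfl, hij⟩, ?_⟩
        rw [attZ_eq_pt_zero_iff hφ he he' (hcl _)]
        exact hia
    rw [this, csInf_singleton]
  have hguard : U (1 - firstB (D.pt 0) fun u => U (1 - u)) = D.pt 0 := by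
    show (fun u => U (1 - u)) (firstB (D.pt 0) fun u => U (1 - u)) = D.pt 0
    rw [rev_guard]; exact hia
  have hj' : (firstB (D.pt 0) fun u => U (1 - u)) = 1 - lastA (D.pt 0) U := rev_firstB (D.pt 0) U
  have hv' : vMid (D.pt 1) (D.pt 0) φ'.boundaryExtension e (fun u => U (1 - u)) = 1 - lastA (D.pt 0) U := by
    show sSup ({u : ℝ | u ∈ Icc (lastA (D.pt 1) fun u => U (1 - u)) (firstB (D.pt 0) fun u => U (1 - u)) ∧
        (fun u => U (1 - u)) (firstB (D.pt 0) fun u => U (1 - u)) = D.pt 0 ∧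
        u = firstB (D.pt 0) fun u => U (1 - u)} ∪
      {u : ℝ | u ∈ Icc (lastA (D.pt 1) fun u => U (1 - u)) (firstB (D.pt 0) fun u => U (1 - u)) ∧
        (fun u => U (1 - u)) (firstB (D.pt 0) fun u => U (1 - u)) ≠ D.pt 0 ∧
        attZ (D.pt 0) φ'.boundaryExtension e (fun u => U (1 - u)) u =
          φ'.boundaryExtension ((rEx (D.pt 1) (D.pt 0) φ'.boundaryExtension e (fun u => U (1 - u)) : ℂ) *
            qEx (D.pt 0) φ'.boundaryExtension e (fun u => U (1 - u)))}) = 1 - lastA (D.pt 0) U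
    have h1 : {u : ℝ | u ∈ Icc (lastA (D.pt 1) fun u => U (1 - u)) (firstB (D.pt 0) fun u => U (1 - u)) ∧
        (fun u => U (1 - u)) (firstB (D.pt 0) fun u => U (1 - u)) = D.pt 0 ∧
        u = firstB (D.pt 0) fun u => U (1 - u)} = {1 - lastA (D.pt 0) U} := by
      ext u
      simp only [mem_setOf_eq, mem_singleton_iff]
      constructor
      · intro h; rw [h.2.2, hj']
      · intro h
        refine ⟨?_, hguard, by rw [h, hj']⟩
        rw [mem_Icc_rev_iff, h, sub_sub_cancel]
        exact ⟨le_rfl, hij⟩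
    have h2 : {u : ℝ | u ∈ Icc (lastA (D.pt 1) fun u => U (1 - u)) (firstB (D.pt 0) fun u => U (1 - u)) ∧
        (fun u => U (1 - u)) (firstB (D.pt 0) fun u => U (1 - u)) ≠ D.pt 0 ∧
        attZ (D.pt 0) φ'.boundaryExtension e (fun u => U (1 - u)) u =
          φ'.boundaryExtension ((rEx (D.pt 1) (D.pt 0) φ'.boundaryExtension e (fun u => U (1 - u)) : ℂ) *
            qEx (D.pt 0) φ'.boundaryExtension e (fun u => U (1 - u)))} = ∅ := by
      ext u
      simp only [mem_setOf_eq, mem_empty_iff_false, iff_false, not_and]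
      exact fun _ h _ => h hguard
    rw [h1, h2, union_empty, csSup_singleton]
  exact ⟨hp, hs, hu, hv'⟩
end Summit.CriticalPhenomena.SAWScalingLimit.Theorems.AttachReversal

end
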